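import Mathlib
import Summits.Ventures.PercRepro.PuncturedLYMSuperMain
import Summits.Ventures.PercRepro.PuncturedLYMTwoCoHypTheorem
import Summits.Ventures.PercRepro.PuncturedLYMSplitOneCoHyp

/-!
# PercRepro — (SP) FOR EVERY FAMILY OF PAIRWISE DISJOINT `j`-SETS WITH `2j + 1 ≤ n`
(p10, gen 37)

A family `D` of pairwise disjoint `j`-sets (`2 ≤ j`) is a CODE (two distinct members meet in `0 ≤ j − 2` points), so the
tree already decides its punctured normalised matching property (SP):

* no member: the classical LYM inequality (`puncturedNMP_empty`);
* one member `C`: the punctured level is `upLevel j C` and gen 36's `puncturedNMP_upLevel_split` applies (`j + 2 ≤ n`);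
* two members: gen 35's two-co-hyperplane theorem `puncturedNMP_union_upLevel` (`2j + 1 ≤ n`);
* three or more members: the ground set has `≥ 3j` points and THEOREM A (`puncturedNMP_of_three_j`, gen 31) applies.

So «(SP) for every pairwise disjoint family of `j`-sets» — the all-sizes-`j` case of the DISJOINT THEOREM targeted by
gen 36 (P10-SPLIT-g36.md §3‴) — is a corollary of theorems already in the tree; the open part of that target is the
MIXED-size case (members of size `< j`, three or more of them).  In the matroid dictionary: the bottom step of (NC)
for every paving matroid of rank `r` on `n ≥ 2(n − r) + 1` points whose nontrivial hyperplanes are circuit-hyperplanes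
(size `r`) with pairwise disjoint complements.
-/

namespace PercRepro.PuncturedLYM

open Finset

variable {α : Type} [Fintype α] [DecidableEq α]

omit [Fintype α] in
/-- Pairwise disjoint `j`-sets form a code when `2 ≤ j`. -/
theorem isCode_of_pairwise_disjoint {j : ℕ} (hj : 2 ≤ j) {D : Finset (Finset α)} (hcard : ∀ B ∈ D, B.card = j)
    (hdisj : ∀ B ∈ D, ∀ B' ∈ D, B ≠ B' → Disjoint B B') : IsCode j D := by
  refine ⟨hcard, fun B hB B' hB' hne => ?_⟩
  rw [disjoint_iff_inter_eq_empty.1 (hdisj B hB B' hB' hne), card_empty]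
  omega

/-- The ground set of `k` pairwise disjoint `j`-sets has at least `k·j` points. -/
theorem card_mul_le_card_of_pairwise_disjoint {j : ℕ} {D : Finset (Finset α)} (hcard : ∀ B ∈ D, B.card = j)
    (hdisj : ∀ B ∈ D, ∀ B' ∈ D, B ≠ B' → Disjoint B B') : D.card * j ≤ Fintype.card α := by
  have h1 : (D.biUnion id).card = ∑ B ∈ D, B.card :=
    card_biUnion (fun B hB B' hB' hne => hdisj B hB B' hB' hne)
  have h2 : ∑ B ∈ D, B.card = D.card * j := by
    rw [Finset.sum_congr rfl (fun B hB => hcard B hB), sum_const, smul_eq_mul]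
  rw [← h2, ← h1]
  exact card_le_univ _

/-- The `j`-sets containing a `j`-set `C` are `{C}`. -/
theorem upLevel_eq_singleton {j : ℕ} {C : Finset α} (hC : C.card = j) : upLevel j C = {C} := by
  ext X
  rw [mem_upLevel, mem_singleton]
  constructor
  · rintro ⟨hX, hCX⟩
    exact (eq_of_subset_of_card_le hCX (by rw [hX, hC])).symm
  · rintro rfl
    exact ⟨hC, subset_rfl⟩

/-- **(SP) for three or more pairwise disjoint `j`-sets** — a corollary of THEOREM A (`3j ≤ n`). -/
theorem puncturedNMP_of_pairwise_disjoint_three {j : ℕ} (hj : 2 ≤ j) {D : Finset (Finset α)}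
    (hcard : ∀ B ∈ D, B.card = j) (hdisj : ∀ B ∈ D, ∀ B' ∈ D, B ≠ B' → Disjoint B B') (hk : 3 ≤ D.card) :
    PuncturedNMP j D := by
  have hn := card_mul_le_card_of_pairwise_disjoint hcard hdisj
  have h3 : 3 * j ≤ Fintype.card α := le_trans (Nat.mul_le_mul_right j hk) hn
  exact puncturedNMP_of_three_j (isCode_of_pairwise_disjoint hj hcard hdisj) (by omega) (by omega) (by omega)

/-- **(SP) FOR EVERY FAMILY OF PAIRWISE DISJOINT `j`-SETS** (`2 ≤ j`, `2j + 1 ≤ n`): by the number of members —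
LYM (none), gen 36 (one), gen 35 (two), Theorem A (three or more). -/
theorem puncturedNMP_of_pairwise_disjoint {j : ℕ} (hj : 2 ≤ j) (hn : 2 * j + 1 ≤ Fintype.card α)
    {D : Finset (Finset α)} (hcard : ∀ B ∈ D, B.card = j)
    (hdisj : ∀ B ∈ D, ∀ B' ∈ D, B ≠ B' → Disjoint B B') : PuncturedNMP j D := by
  rcases Nat.lt_or_ge D.card 3 with hk | hk
  swap
  · exact puncturedNMP_of_pairwise_disjoint_three hj hcard hdisj hk
  rcases Nat.lt_or_ge D.card 2 with hk2 | hk2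
  · rcases Nat.lt_or_ge D.card 1 with hk1 | hk1
    · -- no member
      have hD : D = ∅ := card_eq_zero.1 (by omega)
      subst hD
      exact puncturedNMP_empty (by omega)
    · -- one member
      obtain ⟨C, hC⟩ := card_eq_one.1 (by omega : D.card = 1)
      subst hC
      have hCj : C.card = j := hcard C (mem_singleton_self C)
      rw [← upLevel_eq_singleton hCj]
      exact Split.puncturedNMP_upLevel_split (by omega) hCj.le (by omega)
  · -- two members
    obtain ⟨C₁, C₂, hne, hD⟩ := card_eq_two.1 (by omega : D.card = 2)
    subst hD
    have h₁ : C₁.card = j := hcard C₁ (by simp)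
    have h₂ : C₂.card = j := hcard C₂ (by simp)
    have hdis : Disjoint C₁ C₂ := hdisj C₁ (by simp) C₂ (by simp) hne
    have hU : ({C₁, C₂} : Finset (Finset α)) = upLevel j C₁ ∪ upLevel j C₂ := by
      rw [upLevel_eq_singleton h₁, upLevel_eq_singleton h₂]
      rfl
    rw [hU]
    exact puncturedNMP_union_upLevel hdis (by omega) h₁.le (by omega) h₂.le (by omega) hn

end PercRepro.PuncturedLYM
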